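import Literature.MathematicalPhysics.QuantumLattice.InfVolFermionStateTorusLimitTwoSectorCompanionExistence
import Literature.MathematicalPhysics.QuantumLattice.InfVolFermionStateBounds
import HarnessLib

/-!
# The «rm↑» two-sector rows of the thermal object of record with the exact densities substituted; the
# limit ratio is positive; the a-priori bracket on the canonical removal cost `log r`

Topic `Literature/MathematicalPhysics/QuantumLattice`; complement of
`InfVolFermionStateTorusLimitTwoSectorSingleAnnihilator.lean` / `…TwoSectorReverseRow.lean` (the «rm↑» row of
the thermal object of record `ω` — torus limit of the canonical `(rectN n L, S^z = 0)` Gibbs states — paired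
with a companion `ω'` on the image sectors `(k_L − 1, k_L)` and the limit `r` of `Z_{(k−1,k)}/Z_{(k,k)}`, and
the reversed row of the raising generator with the inverted ratio) and of `…TwoSectorSingleCreator.lean` §1
(brackets from any family of linear rows). For ANY admissible joint data `(ω, ω', r)` along a common
`Ls → ∞` (`0 < n ≤ 2`, resp. `< 2`):

* `IsTorusLimitOfMixture.twoSector_row_annihilation_up_densities_of_sectorGibbs`: the rows with the
  `x`-moment REPLACED by `n/2` and the `y'`-moment by `1 − n/2` (both are one-site densities of
  translation-invariant states with known density rows):
  `0 ≤ β·Re ω_{Λ₁}(c̃†(H_{Λ₁}c̃ − c̃H_{Λ₁})) − s·(n/2) + q·r·(1 − n/2)`, every `Λ ∋ x`, every `e^{s−1} ≤ q`;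
* `…pos_of_tendsto_partitionFn_ratio_predCompanion`: `0 < r` (a limit of positive ratios is `≥ 0`, and
  `r = 0` is excluded by the rows, `not_forall_linear_rows_zero`);
* `…twoSector_row_creation_up_reverse_densities_of_sectorGibbs`: the reversed rows with densities
  substituted, parameter `r⁻¹`: `0 ≤ β·Re ω'_{Λ₁}(c̃(H_{Λ₁}c̃† − c̃†H_{Λ₁})) − s·(1 − n/2) + q·r⁻¹·(n/2)`;
* `…log_partitionFn_ratio_mem_Icc_of_sectorGibbs`: the A-PRIORI BRACKET
  `log(n/(2 − n)) − β·h/(n/2) ≤ log r ≤ log(n/(2 − n)) + β·g'/(1 − n/2)` with the energy moments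
  `h = Re ω_{Λ₁}(c̃†(H_{Λ₁}c̃ − c̃H_{Λ₁}))`, `g' = Re ω'_{Λ₁}(c̃(H_{Λ₁}c̃† − c̃†H_{Λ₁}))` (Araki–Sewell optimised over
  `s`; at `β = 0` the bracket collapses to the free-lattice-gas value `log(n/(2 − n))`);
* `…log_partitionFn_ratio_mem_Icc_norm_of_sectorGibbs`: the STATE-FREE form with `|h| ≤ ‖X₁‖`,
  `|g'| ≤ ‖X₁'‖` (`InfVolFermionState.abs_re_expect_le`; operator norms of two fixed local matrices,
  independent of `L`, of the states and of `β`) — the compact interval a relaxation scans `r` over.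

* §2 `…twoSector_moments_compat_of_sectorGibbs`: the two brackets are compatible — the `r`-FREE, `β`-free
  joint row `0 ≤ h/(n/2) + g'/(1 − n/2)` of the pair `(ω, ω')`.

HONEST SCOPE: rows and brackets for PAIRS of states; the operator norms are not evaluated here (a closed
form `≤ 4|t| + 4|t'| + |U|`-type bound on the local commutator is not claimed); no number, no equivalence
of ensembles. Everything is PROVED; no definition, no named fact.

## Mathlib / tree search

REUSED: `…re_expect_twoSector_eeb_annihilation_up_nonneg_of_sectorGibbs` (`…SingleAnnihilator`),
`…re_expect_twoSector_eeb_creation_up_reverse_nonneg_of_sectorGibbs`, the moment/density lemmas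
(`…TwoSectorReverseRow`), `not_forall_linear_rows_zero` (`…TwoSectorCompanionExistence`),
`log_div_sub_div_le_log_of_forall_linear_rows`, `log_le_log_div_add_div_of_forall_linear_rows`
(`…SingleCreator`), `InfVolFermionState.abs_re_expect_le` (`InfVolFermionStateBounds`), Mathlib
`ge_of_tendsto'`, `Filter.Tendsto.inv₀`, `inv_div`. `lean search 'log_partitionFn_ratio_mem_Icc'`: nothing
(2026-08-27).

## References

* O. Bratteli, D. W. Robinson, *Operator Algebras and Quantum Statistical Mechanics 2* (1997), Thm. 5.3.15,
  §5.4.2. [cite: BratteliRobinsonII1997, §5.4.2]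
* O. Bratteli, D. W. Robinson, *Operator Algebras and Quantum Statistical Mechanics 1* (1987), Prop. 2.3.11
  (states are contractive). [cite: BratteliRobinsonI1987, Prop. 2.3.11]
* H. Fawzi, O. Fawzi, S. O. Scalet (2024), Thm. 3.1. [cite: FawziFawziScalet2024, Thm. 3.1]
* D. Ruelle, *Statistical Mechanics: Rigorous Results* (1969), §3.4. [cite: Ruelle1969, §3.4]
* R. B. Israel, *Convexity in the Theory of Lattice Gases* (1979), Lemma II.3.1. [cite: Israel1979, Lemma II.3.1]
-/

noncomputable section

namespace Literature.MathematicalPhysics.QuantumLattice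

open Matrix Finset HubbardWave0 Literature.Probability.LatticeModels ThermodynamicLimit
open _root_.Filter
open scoped _root_.Topology ComplexOrder BigOperators

/-! ### §1 For ANY admissible joint data: `r > 0`, the rows with the exact densities substituted, and the
a-priori bracket on the canonical removal cost `log r` -/

section Bracket

variable (t t' U β : ℝ)

/-- The ratio `Z_{(k−1,k)}(L)/Z_{(k,k)}(L)` is positive at every side (`0 ≤ n ≤ 2`: both sectors are
nonempty). [cite: Israel1979, Lemma II.3.1] -/
theorem partitionFn_ratio_predCompanion_pos {n : ℝ} (hn0 : 0 ≤ n) (hn2 : n ≤ 2) (L : ℕ) :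
    0 < (∑ d, Real.exp (-(β * sectorEigenvalue (spinConfig (halfRectN n L - 1) (halfRectN n L))
        (hubbardTorusTT' L t t' U) (hubbardTorusTT'_isHermitian L t t' U) d))) /
      (∑ c, Real.exp (-(β * sectorEigenvalue (szConfig n L) (hubbardTorusTT' L t t' U)
        (hubbardTorusTT'_isHermitian L t t' U) c))) := by
  obtain ⟨s₁, hs₁⟩ := exists_spinConfig_of_le L ((Nat.sub_le _ _).trans (halfRectN_le_mul_self hn0 hn2 L))
    (halfRectN_le_mul_self hn0 hn2 L)
  haveI : Nonempty (Subtype (spinConfig (Λ := FermionTorus 2 L) (halfRectN n L - 1) (halfRectN n L))) := ⟨⟨s₁, hs₁⟩⟩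
  obtain ⟨s₀, hs₀⟩ := exists_szConfig hn0 hn2 L
  haveI : Nonempty (Subtype (szConfig n L)) := ⟨⟨s₀, hs₀⟩⟩
  exact div_pos (Finset.sum_pos (fun _ _ => Real.exp_pos _) Finset.univ_nonempty)
    (Finset.sum_pos (fun _ _ => Real.exp_pos _) Finset.univ_nonempty)

/-- **The «rm↑» rows with the exact densities substituted.** For the object of record `ω` (`0 < n ≤ 2`), a
companion `ω'` on `(k_L − 1, k_L)` along the same `Ls` and the limit `r` of the ratio: for every region
`Λ ∋ x` and all `e^{s−1} ≤ q`,
`0 ≤ β·Re ω_{Λ₁}(c̃†(H_{Λ₁}c̃ − c̃H_{Λ₁})) − s·(n/2) + q·r·(1 − n/2)` — the `x`-moment IS `n/2` and the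
`y'`-moment IS `1 − n/2` (translation invariance + the density rows of both states).
[cite: FawziFawziScalet2024, Thm. 3.1] [cite: BratteliRobinsonII1997, §5.4.2] [cite: Ruelle1969, §3.4] -/
theorem InfVolFermionState.IsTorusLimitOfMixture.twoSector_row_annihilation_up_densities_of_sectorGibbs
    {n : ℝ} (hn0 : 0 < n) (hn2 : n ≤ 2) {Ls : ℕ → ℕ} (hLs : Tendsto Ls atTop atTop)
    {ω ω' : InfVolFermionState 2}
    (hω : ω.IsTorusLimitOfMixture (sectorGibbsCount n) (fun L => sectorGibbsWeightTT' β t t' U n L)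
      (fun L => sectorGibbsVectorTT' t t' U n L) Ls)
    (hω' : ω'.IsTorusLimitOfMixture
      (fun L => Fintype.card (Subtype (spinConfig (Λ := FermionTorus 2 L) (halfRectN n L - 1) (halfRectN n L))))
      (fun L i => canonicalWeight β (sectorEigenvalue (spinConfig (halfRectN n L - 1) (halfRectN n L))
        (hubbardTorusTT' L t t' U) (hubbardTorusTT'_isHermitian L t t' U)) ((Fintype.equivFin _).symm i))
      (fun L i => sectorEigenvector (spinConfig (halfRectN n L - 1) (halfRectN n L)) (hubbardTorusTT' L t t' U)
        (hubbardTorusTT'_isHermitian L t t' U) ((Fintype.equivFin _).symm i)) Ls)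
    {r : ℝ} (hr : Tendsto (fun j =>
      (∑ d, Real.exp (-(β * sectorEigenvalue (spinConfig (halfRectN n (Ls j) - 1) (halfRectN n (Ls j)))
          (hubbardTorusTT' (Ls j) t t' U) (hubbardTorusTT'_isHermitian (Ls j) t t' U) d))) /
        ∑ c, Real.exp (-(β * sectorEigenvalue (szConfig n (Ls j)) (hubbardTorusTT' (Ls j) t t' U)
          (hubbardTorusTT'_isHermitian (Ls j) t t' U) c))) atTop (𝓝 r))
    {Λ : Finset (Site 2)} {x : Site 2} (hx : x ∈ Λ) {s q : ℝ} (hq : Real.exp (s - 1) ≤ q) :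
    0 ≤ β * (ω.expect (thicken Λ 1)
          ((fermionEmbed (PolySite.incl (subset_thicken Λ 1)) (annihilation (orb (PolySite.pt x hx) 0)))ᴴ *
            ((hubbardTTPrimeFermionInteraction t t' U).localHamiltonian (thicken Λ 1) *
                fermionEmbed (PolySite.incl (subset_thicken Λ 1)) (annihilation (orb (PolySite.pt x hx) 0)) -
              fermionEmbed (PolySite.incl (subset_thicken Λ 1)) (annihilation (orb (PolySite.pt x hx) 0)) *
                (hubbardTTPrimeFermionInteraction t t' U).localHamiltonian (thicken Λ 1)))).re -
        s * (n / 2) + q * r * (1 - n / 2) := by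
  have h := hω.re_expect_twoSector_eeb_annihilation_up_nonneg_of_sectorGibbs t t' U β hn0 hLs hω' hr hx hq
  rwa [hω.isTranslationInvariant.expect_conjTranspose_mul_fermionEmbed_incl_cAt,
    hω'.isTranslationInvariant.expect_fermionEmbed_incl_cAt_mul_conjTranspose, Complex.sub_re, Complex.one_re,
    hω.re_expect_nAt_eq_half_of_sectorGibbs t t' U β hn0.le hn2 hLs 0,
    hω'.re_expect_nAt_up_eq_half_of_predCompanion t t' U β hn0.le hn2 hLs] at h

/-- **The limit of the ratio is POSITIVE** for every admissible joint data `(ω, ω', r)` of the «rm↑» rows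
(`0 < n ≤ 2`): it is `≥ 0` as a limit of positive numbers, and `r = 0` would leave the rows
`0 ≤ βh − s·n/2` for all `s`. [cite: BratteliRobinsonII1997, §5.4.2] -/
theorem InfVolFermionState.IsTorusLimitOfMixture.pos_of_tendsto_partitionFn_ratio_predCompanion
    {n : ℝ} (hn0 : 0 < n) (hn2 : n ≤ 2) {Ls : ℕ → ℕ} (hLs : Tendsto Ls atTop atTop)
    {ω ω' : InfVolFermionState 2}
    (hω : ω.IsTorusLimitOfMixture (sectorGibbsCount n) (fun L => sectorGibbsWeightTT' β t t' U n L)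
      (fun L => sectorGibbsVectorTT' t t' U n L) Ls)
    (hω' : ω'.IsTorusLimitOfMixture
      (fun L => Fintype.card (Subtype (spinConfig (Λ := FermionTorus 2 L) (halfRectN n L - 1) (halfRectN n L))))
      (fun L i => canonicalWeight β (sectorEigenvalue (spinConfig (halfRectN n L - 1) (halfRectN n L))
        (hubbardTorusTT' L t t' U) (hubbardTorusTT'_isHermitian L t t' U)) ((Fintype.equivFin _).symm i))
      (fun L i => sectorEigenvector (spinConfig (halfRectN n L - 1) (halfRectN n L)) (hubbardTorusTT' L t t' U)
        (hubbardTorusTT'_isHermitian L t t' U) ((Fintype.equivFin _).symm i)) Ls)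
    {r : ℝ} (hr : Tendsto (fun j =>
      (∑ d, Real.exp (-(β * sectorEigenvalue (spinConfig (halfRectN n (Ls j) - 1) (halfRectN n (Ls j)))
          (hubbardTorusTT' (Ls j) t t' U) (hubbardTorusTT'_isHermitian (Ls j) t t' U) d))) /
        ∑ c, Real.exp (-(β * sectorEigenvalue (szConfig n (Ls j)) (hubbardTorusTT' (Ls j) t t' U)
          (hubbardTorusTT'_isHermitian (Ls j) t t' U) c))) atTop (𝓝 r)) :
    0 < r := by
  have hr0 : 0 ≤ r :=
    ge_of_tendsto' hr fun j => (partitionFn_ratio_predCompanion_pos t t' U β hn0.le hn2 (Ls j)).le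
  rcases hr0.lt_or_eq with h | h
  · exact h
  · exfalso
    subst h
    exact not_forall_linear_rows_zero (half_pos hn0) fun s q hq => by
      have h := hω.twoSector_row_annihilation_up_densities_of_sectorGibbs t t' U β hn0 hn2 hLs hω' hr
        (Λ := {0}) (x := 0) (Finset.mem_singleton_self 0) hq
      exact h

/-- **The REVERSED rows with the exact densities substituted** (`0 < n ≤ 2`, `r > 0` automatic):
`0 ≤ β·Re ω'_{Λ₁}(c̃(H_{Λ₁}c̃† − c̃†H_{Λ₁})) − s·(1 − n/2) + q·r⁻¹·(n/2)`.
[cite: FawziFawziScalet2024, Thm. 3.1] [cite: BratteliRobinsonII1997, §5.4.2] [cite: Ruelle1969, §3.4] -/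
theorem InfVolFermionState.IsTorusLimitOfMixture.twoSector_row_creation_up_reverse_densities_of_sectorGibbs
    {n : ℝ} (hn0 : 0 < n) (hn2 : n ≤ 2) {Ls : ℕ → ℕ} (hLs : Tendsto Ls atTop atTop)
    {ω ω' : InfVolFermionState 2}
    (hω : ω.IsTorusLimitOfMixture (sectorGibbsCount n) (fun L => sectorGibbsWeightTT' β t t' U n L)
      (fun L => sectorGibbsVectorTT' t t' U n L) Ls)
    (hω' : ω'.IsTorusLimitOfMixture
      (fun L => Fintype.card (Subtype (spinConfig (Λ := FermionTorus 2 L) (halfRectN n L - 1) (halfRectN n L))))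
      (fun L i => canonicalWeight β (sectorEigenvalue (spinConfig (halfRectN n L - 1) (halfRectN n L))
        (hubbardTorusTT' L t t' U) (hubbardTorusTT'_isHermitian L t t' U)) ((Fintype.equivFin _).symm i))
      (fun L i => sectorEigenvector (spinConfig (halfRectN n L - 1) (halfRectN n L)) (hubbardTorusTT' L t t' U)
        (hubbardTorusTT'_isHermitian L t t' U) ((Fintype.equivFin _).symm i)) Ls)
    {r : ℝ} (hr : Tendsto (fun j =>
      (∑ d, Real.exp (-(β * sectorEigenvalue (spinConfig (halfRectN n (Ls j) - 1) (halfRectN n (Ls j)))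
          (hubbardTorusTT' (Ls j) t t' U) (hubbardTorusTT'_isHermitian (Ls j) t t' U) d))) /
        ∑ c, Real.exp (-(β * sectorEigenvalue (szConfig n (Ls j)) (hubbardTorusTT' (Ls j) t t' U)
          (hubbardTorusTT'_isHermitian (Ls j) t t' U) c))) atTop (𝓝 r))
    {Λ : Finset (Site 2)} {x : Site 2} (hx : x ∈ Λ) {s q : ℝ} (hq : Real.exp (s - 1) ≤ q) :
    0 ≤ β * (ω'.expect (thicken Λ 1)
          (fermionEmbed (PolySite.incl (subset_thicken Λ 1)) (annihilation (orb (PolySite.pt x hx) 0)) *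
            ((hubbardTTPrimeFermionInteraction t t' U).localHamiltonian (thicken Λ 1) *
                (fermionEmbed (PolySite.incl (subset_thicken Λ 1)) (annihilation (orb (PolySite.pt x hx) 0)))ᴴ -
              (fermionEmbed (PolySite.incl (subset_thicken Λ 1)) (annihilation (orb (PolySite.pt x hx) 0)))ᴴ *
                (hubbardTTPrimeFermionInteraction t t' U).localHamiltonian (thicken Λ 1)))).re -
        s * (1 - n / 2) + q * r⁻¹ * (n / 2) := by
  have hrpos := hω.pos_of_tendsto_partitionFn_ratio_predCompanion t t' U β hn0 hn2 hLs hω' hr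
  have hr' : Tendsto (fun j =>
      (∑ c, Real.exp (-(β * sectorEigenvalue (szConfig n (Ls j)) (hubbardTorusTT' (Ls j) t t' U)
          (hubbardTorusTT'_isHermitian (Ls j) t t' U) c))) /
        ∑ d, Real.exp (-(β * sectorEigenvalue (spinConfig (halfRectN n (Ls j) - 1) (halfRectN n (Ls j)))
          (hubbardTorusTT' (Ls j) t t' U) (hubbardTorusTT'_isHermitian (Ls j) t t' U) d))) atTop (𝓝 r⁻¹) := by
    refine (hr.inv₀ hrpos.ne').congr fun j => ?_
    rw [inv_div]
  have h := hω.re_expect_twoSector_eeb_creation_up_reverse_nonneg_of_sectorGibbs t t' U β hn0 hLs hω' hr' hx hq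
  rwa [← annihilation_conjTranspose, fermionEmbed_conjTranspose, conjTranspose_conjTranspose,
    hω'.isTranslationInvariant.expect_fermionEmbed_incl_cAt_mul_conjTranspose,
    hω.isTranslationInvariant.expect_conjTranspose_mul_fermionEmbed_incl_cAt, Complex.sub_re, Complex.one_re,
    hω.re_expect_nAt_eq_half_of_sectorGibbs t t' U β hn0.le hn2 hLs 0,
    hω'.re_expect_nAt_up_eq_half_of_predCompanion t t' U β hn0.le hn2 hLs] at h

/-- `(n/2)/(1 − n/2) = n/(2 − n)`. [folklore] -/
private theorem half_div_one_sub_half (n : ℝ) : n / 2 / (1 - n / 2) = n / (2 - n) := by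
  rcases eq_or_ne n 2 with rfl | hn
  · norm_num
  · have h2 : (2 - n) ≠ 0 := sub_ne_zero.2 (Ne.symm hn)
    have h2' : (1 - n / 2) ≠ 0 := by
      intro h; apply hn; linarith
    rw [div_div, mul_sub, mul_one, mul_div_cancel₀ _ (two_ne_zero (α := ℝ))]

/-- **A-priori bracket on the canonical one-particle removal cost, thermodynamic limit.** For the object
of record `ω` (`0 < n < 2`), every companion `ω'` on `(k_L − 1, k_L)` along the same `Ls` and the limit `r`
of `Z_{(k−1,k)}/Z_{(k,k)}` (`βμ⁻_can = log r`), and every region `Λ ∋ x`: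
`log(n/(2 − n)) − β·h/(n/2) ≤ log r ≤ log(n/(2 − n)) + β·g'/(1 − n/2)`, with the energy moments
`h = Re ω_{Λ₁}(c̃†(H_{Λ₁}c̃ − c̃H_{Λ₁}))`, `g' = Re ω'_{Λ₁}(c̃(H_{Λ₁}c̃† − c̃†H_{Λ₁}))` (`c̃ = Γ_{Λ⊆Λ₁}c_{x↑}`). At
`β = 0` the bracket collapses to the free-lattice-gas value `log(n/(2 − n))`.
[cite: BratteliRobinsonII1997, §5.4.2] [cite: FawziFawziScalet2024, Thm. 3.1] -/
theorem InfVolFermionState.IsTorusLimitOfMixture.log_partitionFn_ratio_mem_Icc_of_sectorGibbs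
    {n : ℝ} (hn0 : 0 < n) (hn2 : n < 2) {Ls : ℕ → ℕ} (hLs : Tendsto Ls atTop atTop)
    {ω ω' : InfVolFermionState 2}
    (hω : ω.IsTorusLimitOfMixture (sectorGibbsCount n) (fun L => sectorGibbsWeightTT' β t t' U n L)
      (fun L => sectorGibbsVectorTT' t t' U n L) Ls)
    (hω' : ω'.IsTorusLimitOfMixture
      (fun L => Fintype.card (Subtype (spinConfig (Λ := FermionTorus 2 L) (halfRectN n L - 1) (halfRectN n L))))
      (fun L i => canonicalWeight β (sectorEigenvalue (spinConfig (halfRectN n L - 1) (halfRectN n L))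
        (hubbardTorusTT' L t t' U) (hubbardTorusTT'_isHermitian L t t' U)) ((Fintype.equivFin _).symm i))
      (fun L i => sectorEigenvector (spinConfig (halfRectN n L - 1) (halfRectN n L)) (hubbardTorusTT' L t t' U)
        (hubbardTorusTT'_isHermitian L t t' U) ((Fintype.equivFin _).symm i)) Ls)
    {r : ℝ} (hr : Tendsto (fun j =>
      (∑ d, Real.exp (-(β * sectorEigenvalue (spinConfig (halfRectN n (Ls j) - 1) (halfRectN n (Ls j)))
          (hubbardTorusTT' (Ls j) t t' U) (hubbardTorusTT'_isHermitian (Ls j) t t' U) d))) /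
        ∑ c, Real.exp (-(β * sectorEigenvalue (szConfig n (Ls j)) (hubbardTorusTT' (Ls j) t t' U)
          (hubbardTorusTT'_isHermitian (Ls j) t t' U) c))) atTop (𝓝 r))
    {Λ : Finset (Site 2)} {x : Site 2} (hx : x ∈ Λ) :
    Real.log (n / (2 - n)) -
        β * (ω.expect (thicken Λ 1)
          ((fermionEmbed (PolySite.incl (subset_thicken Λ 1)) (annihilation (orb (PolySite.pt x hx) 0)))ᴴ *
            ((hubbardTTPrimeFermionInteraction t t' U).localHamiltonian (thicken Λ 1) *
                fermionEmbed (PolySite.incl (subset_thicken Λ 1)) (annihilation (orb (PolySite.pt x hx) 0)) -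
              fermionEmbed (PolySite.incl (subset_thicken Λ 1)) (annihilation (orb (PolySite.pt x hx) 0)) *
                (hubbardTTPrimeFermionInteraction t t' U).localHamiltonian (thicken Λ 1)))).re / (n / 2) ≤
      Real.log r ∧
    Real.log r ≤ Real.log (n / (2 - n)) +
        β * (ω'.expect (thicken Λ 1)
          (fermionEmbed (PolySite.incl (subset_thicken Λ 1)) (annihilation (orb (PolySite.pt x hx) 0)) *
            ((hubbardTTPrimeFermionInteraction t t' U).localHamiltonian (thicken Λ 1) *
                (fermionEmbed (PolySite.incl (subset_thicken Λ 1)) (annihilation (orb (PolySite.pt x hx) 0)))ᴴ -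
              (fermionEmbed (PolySite.incl (subset_thicken Λ 1)) (annihilation (orb (PolySite.pt x hx) 0)))ᴴ *
                (hubbardTTPrimeFermionInteraction t t' U).localHamiltonian (thicken Λ 1)))).re / (1 - n / 2) := by
  have hx0 : 0 < n / 2 := half_pos hn0
  have hy0 : 0 < 1 - n / 2 := by linarith
  have hrpos := hω.pos_of_tendsto_partitionFn_ratio_predCompanion t t' U β hn0 hn2.le hLs hω' hr
  rw [← half_div_one_sub_half]
  refine ⟨log_div_sub_div_le_log_of_forall_linear_rows hx0 hy0 hrpos fun s q hq =>
      hω.twoSector_row_annihilation_up_densities_of_sectorGibbs t t' U β hn0 hn2.le hLs hω' hr hx hq,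
    log_le_log_div_add_div_of_forall_linear_rows hx0 hy0 hrpos fun s q hq =>
      hω.twoSector_row_creation_up_reverse_densities_of_sectorGibbs t t' U β hn0 hn2.le hLs hω' hr hx hq⟩

open scoped Matrix.Norms.L2Operator in
/-- **The state-free form of the bracket**: with `C = ‖c̃†(H_{Λ₁}c̃ − c̃H_{Λ₁})‖` and
`C' = ‖c̃(H_{Λ₁}c̃† − c̃†H_{Λ₁})‖` (operator norms of two FIXED local matrices, independent of `L`, of the
states and of `β`): `log(n/(2 − n)) − |β|·C/(n/2) ≤ log r ≤ log(n/(2 − n)) + |β|·C'/(1 − n/2)` — an explicit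
compact bracket containing the parameter `r` of every admissible joint data, as a relaxation scanning `r`
needs. [cite: BratteliRobinsonI1987, Prop. 2.3.11] [cite: BratteliRobinsonII1997, §5.4.2] -/
theorem InfVolFermionState.IsTorusLimitOfMixture.log_partitionFn_ratio_mem_Icc_norm_of_sectorGibbs
    {n : ℝ} (hn0 : 0 < n) (hn2 : n < 2) {Ls : ℕ → ℕ} (hLs : Tendsto Ls atTop atTop)
    {ω ω' : InfVolFermionState 2}
    (hω : ω.IsTorusLimitOfMixture (sectorGibbsCount n) (fun L => sectorGibbsWeightTT' β t t' U n L)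
      (fun L => sectorGibbsVectorTT' t t' U n L) Ls)
    (hω' : ω'.IsTorusLimitOfMixture
      (fun L => Fintype.card (Subtype (spinConfig (Λ := FermionTorus 2 L) (halfRectN n L - 1) (halfRectN n L))))
      (fun L i => canonicalWeight β (sectorEigenvalue (spinConfig (halfRectN n L - 1) (halfRectN n L))
        (hubbardTorusTT' L t t' U) (hubbardTorusTT'_isHermitian L t t' U)) ((Fintype.equivFin _).symm i))
      (fun L i => sectorEigenvector (spinConfig (halfRectN n L - 1) (halfRectN n L)) (hubbardTorusTT' L t t' U)
        (hubbardTorusTT'_isHermitian L t t' U) ((Fintype.equivFin _).symm i)) Ls)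
    {r : ℝ} (hr : Tendsto (fun j =>
      (∑ d, Real.exp (-(β * sectorEigenvalue (spinConfig (halfRectN n (Ls j) - 1) (halfRectN n (Ls j)))
          (hubbardTorusTT' (Ls j) t t' U) (hubbardTorusTT'_isHermitian (Ls j) t t' U) d))) /
        ∑ c, Real.exp (-(β * sectorEigenvalue (szConfig n (Ls j)) (hubbardTorusTT' (Ls j) t t' U)
          (hubbardTorusTT'_isHermitian (Ls j) t t' U) c))) atTop (𝓝 r))
    {Λ : Finset (Site 2)} {x : Site 2} (hx : x ∈ Λ) :
    Real.log (n / (2 - n)) -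
        |β| * ‖(fermionEmbed (PolySite.incl (subset_thicken Λ 1)) (annihilation (orb (PolySite.pt x hx) 0)))ᴴ *
            ((hubbardTTPrimeFermionInteraction t t' U).localHamiltonian (thicken Λ 1) *
                fermionEmbed (PolySite.incl (subset_thicken Λ 1)) (annihilation (orb (PolySite.pt x hx) 0)) -
              fermionEmbed (PolySite.incl (subset_thicken Λ 1)) (annihilation (orb (PolySite.pt x hx) 0)) *
                (hubbardTTPrimeFermionInteraction t t' U).localHamiltonian (thicken Λ 1))‖ / (n / 2) ≤
      Real.log r ∧
    Real.log r ≤ Real.log (n / (2 - n)) +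
        |β| * ‖fermionEmbed (PolySite.incl (subset_thicken Λ 1)) (annihilation (orb (PolySite.pt x hx) 0)) *
            ((hubbardTTPrimeFermionInteraction t t' U).localHamiltonian (thicken Λ 1) *
                (fermionEmbed (PolySite.incl (subset_thicken Λ 1)) (annihilation (orb (PolySite.pt x hx) 0)))ᴴ -
              (fermionEmbed (PolySite.incl (subset_thicken Λ 1)) (annihilation (orb (PolySite.pt x hx) 0)))ᴴ *
                (hubbardTTPrimeFermionInteraction t t' U).localHamiltonian (thicken Λ 1))‖ / (1 - n / 2) := by
  have hx0 : 0 < n / 2 := half_pos hn0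
  have hy0 : 0 < 1 - n / 2 := by linarith
  obtain ⟨hlo, hhi⟩ := hω.log_partitionFn_ratio_mem_Icc_of_sectorGibbs t t' U β hn0 hn2 hLs hω' hr hx
  set X₁ := (fermionEmbed (PolySite.incl (subset_thicken Λ 1)) (annihilation (orb (PolySite.pt x hx) 0)))ᴴ *
      ((hubbardTTPrimeFermionInteraction t t' U).localHamiltonian (thicken Λ 1) *
          fermionEmbed (PolySite.incl (subset_thicken Λ 1)) (annihilation (orb (PolySite.pt x hx) 0)) -
        fermionEmbed (PolySite.incl (subset_thicken Λ 1)) (annihilation (orb (PolySite.pt x hx) 0)) *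
          (hubbardTTPrimeFermionInteraction t t' U).localHamiltonian (thicken Λ 1)) with hX₁
  set X₂ := fermionEmbed (PolySite.incl (subset_thicken Λ 1)) (annihilation (orb (PolySite.pt x hx) 0)) *
      ((hubbardTTPrimeFermionInteraction t t' U).localHamiltonian (thicken Λ 1) *
          (fermionEmbed (PolySite.incl (subset_thicken Λ 1)) (annihilation (orb (PolySite.pt x hx) 0)))ᴴ -
        (fermionEmbed (PolySite.incl (subset_thicken Λ 1)) (annihilation (orb (PolySite.pt x hx) 0)))ᴴ *
          (hubbardTTPrimeFermionInteraction t t' U).localHamiltonian (thicken Λ 1)) with hX₂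
  have h₁ : |β * (ω.expect (thicken Λ 1) X₁).re| ≤ |β| * ‖X₁‖ := by
    rw [abs_mul]
    exact mul_le_mul_of_nonneg_left (ω.abs_re_expect_le _ X₁) (abs_nonneg β)
  have h₂ : |β * (ω'.expect (thicken Λ 1) X₂).re| ≤ |β| * ‖X₂‖ := by
    rw [abs_mul]
    exact mul_le_mul_of_nonneg_left (ω'.abs_re_expect_le _ X₂) (abs_nonneg β)
  have h₁' : β * (ω.expect (thicken Λ 1) X₁).re / (n / 2) ≤ |β| * ‖X₁‖ / (n / 2) :=
    div_le_div_of_nonneg_right ((le_abs_self _).trans h₁) hx0.le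
  have h₂' : β * (ω'.expect (thicken Λ 1) X₂).re / (1 - n / 2) ≤ |β| * ‖X₂‖ / (1 - n / 2) :=
    div_le_div_of_nonneg_right ((le_abs_self _).trans h₂) hy0.le
  constructor <;> linarith

/-! ### §2 The `r`-FREE joint row: the two brackets are compatible -/

/-- **An `r`-free, `β`-free joint row of the pair `(ω, ω')`.** For admissible joint data of the «rm↑» rows
at `β > 0` (`0 < n < 2`) and every region `Λ ∋ x`: `0 ≤ h/(n/2) + g'/(1 − n/2)` with the energy moments
`h = Re ω_{Λ₁}(c̃†(H_{Λ₁}c̃ − c̃H_{Λ₁}))`, `g' = Re ω'_{Λ₁}(c̃(H_{Λ₁}c̃† − c̃†H_{Λ₁}))` — the lower bracket on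
`log r` (from `ω`) may not exceed the upper one (from `ω'`); `β` and `r` cancel. With a certified cap
`g' ≤ g'_max` on the companion (reader `…ThermalWindowCertificateSpinSector`) this is a single-state row
`h ≥ −(n/(2 − n))·g'_max` for `ω`. [cite: BratteliRobinsonII1997, §5.4.2] [cite: FawziFawziScalet2024, Thm. 3.1] -/
theorem InfVolFermionState.IsTorusLimitOfMixture.twoSector_moments_compat_of_sectorGibbs
    (hβ : 0 < β) {n : ℝ} (hn0 : 0 < n) (hn2 : n < 2) {Ls : ℕ → ℕ} (hLs : Tendsto Ls atTop atTop)
    {ω ω' : InfVolFermionState 2}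
    (hω : ω.IsTorusLimitOfMixture (sectorGibbsCount n) (fun L => sectorGibbsWeightTT' β t t' U n L)
      (fun L => sectorGibbsVectorTT' t t' U n L) Ls)
    (hω' : ω'.IsTorusLimitOfMixture
      (fun L => Fintype.card (Subtype (spinConfig (Λ := FermionTorus 2 L) (halfRectN n L - 1) (halfRectN n L))))
      (fun L i => canonicalWeight β (sectorEigenvalue (spinConfig (halfRectN n L - 1) (halfRectN n L))
        (hubbardTorusTT' L t t' U) (hubbardTorusTT'_isHermitian L t t' U)) ((Fintype.equivFin _).symm i))
      (fun L i => sectorEigenvector (spinConfig (halfRectN n L - 1) (halfRectN n L)) (hubbardTorusTT' L t t' U)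
        (hubbardTorusTT'_isHermitian L t t' U) ((Fintype.equivFin _).symm i)) Ls)
    {r : ℝ} (hr : Tendsto (fun j =>
      (∑ d, Real.exp (-(β * sectorEigenvalue (spinConfig (halfRectN n (Ls j) - 1) (halfRectN n (Ls j)))
          (hubbardTorusTT' (Ls j) t t' U) (hubbardTorusTT'_isHermitian (Ls j) t t' U) d))) /
        ∑ c, Real.exp (-(β * sectorEigenvalue (szConfig n (Ls j)) (hubbardTorusTT' (Ls j) t t' U)
          (hubbardTorusTT'_isHermitian (Ls j) t t' U) c))) atTop (𝓝 r))
    {Λ : Finset (Site 2)} {x : Site 2} (hx : x ∈ Λ) :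
    0 ≤ (ω.expect (thicken Λ 1)
          ((fermionEmbed (PolySite.incl (subset_thicken Λ 1)) (annihilation (orb (PolySite.pt x hx) 0)))ᴴ *
            ((hubbardTTPrimeFermionInteraction t t' U).localHamiltonian (thicken Λ 1) *
                fermionEmbed (PolySite.incl (subset_thicken Λ 1)) (annihilation (orb (PolySite.pt x hx) 0)) -
              fermionEmbed (PolySite.incl (subset_thicken Λ 1)) (annihilation (orb (PolySite.pt x hx) 0)) *
                (hubbardTTPrimeFermionInteraction t t' U).localHamiltonian (thicken Λ 1)))).re / (n / 2) +
      (ω'.expect (thicken Λ 1)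
          (fermionEmbed (PolySite.incl (subset_thicken Λ 1)) (annihilation (orb (PolySite.pt x hx) 0)) *
            ((hubbardTTPrimeFermionInteraction t t' U).localHamiltonian (thicken Λ 1) *
                (fermionEmbed (PolySite.incl (subset_thicken Λ 1)) (annihilation (orb (PolySite.pt x hx) 0)))ᴴ -
              (fermionEmbed (PolySite.incl (subset_thicken Λ 1)) (annihilation (orb (PolySite.pt x hx) 0)))ᴴ *
                (hubbardTTPrimeFermionInteraction t t' U).localHamiltonian (thicken Λ 1)))).re / (1 - n / 2) := by
  obtain ⟨hlo, hhi⟩ := hω.log_partitionFn_ratio_mem_Icc_of_sectorGibbs t t' U β hn0 hn2 hLs hω' hr hx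
  have hx0 : 0 < n / 2 := half_pos hn0
  have hy0 : 0 < 1 - n / 2 := by linarith
  set h := (ω.expect (thicken Λ 1)
          ((fermionEmbed (PolySite.incl (subset_thicken Λ 1)) (annihilation (orb (PolySite.pt x hx) 0)))ᴴ *
            ((hubbardTTPrimeFermionInteraction t t' U).localHamiltonian (thicken Λ 1) *
                fermionEmbed (PolySite.incl (subset_thicken Λ 1)) (annihilation (orb (PolySite.pt x hx) 0)) -
              fermionEmbed (PolySite.incl (subset_thicken Λ 1)) (annihilation (orb (PolySite.pt x hx) 0)) *
                (hubbardTTPrimeFermionInteraction t t' U).localHamiltonian (thicken Λ 1)))).re with hh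
  set g := (ω'.expect (thicken Λ 1)
          (fermionEmbed (PolySite.incl (subset_thicken Λ 1)) (annihilation (orb (PolySite.pt x hx) 0)) *
            ((hubbardTTPrimeFermionInteraction t t' U).localHamiltonian (thicken Λ 1) *
                (fermionEmbed (PolySite.incl (subset_thicken Λ 1)) (annihilation (orb (PolySite.pt x hx) 0)))ᴴ -
              (fermionEmbed (PolySite.incl (subset_thicken Λ 1)) (annihilation (orb (PolySite.pt x hx) 0)))ᴴ *
                (hubbardTTPrimeFermionInteraction t t' U).localHamiltonian (thicken Λ 1)))).re with hg
  -- `−βh/x ≤ βg/y'`, divide by `β > 0`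
  have h1 : -(β * h / (n / 2)) ≤ β * g / (1 - n / 2) := by linarith
  have h2 : β * (h / (n / 2) + g / (1 - n / 2)) = β * h / (n / 2) + β * g / (1 - n / 2) := by ring
  have h3 : 0 ≤ β * (h / (n / 2) + g / (1 - n / 2)) := by rw [h2]; linarith
  exact (mul_nonneg_iff_of_pos_left hβ).1 h3

end Bracket

end Literature.MathematicalPhysics.QuantumLattice

end
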